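import Mathlib
import Summits.KontsevichZagierPeriods.KontsevichZagierPeriods.Theses.Grothendieck
import Literature.NumberTheory.Transcendental.MZVSimplexRep
import Literature.NumberTheory.Transcendental.KZUnfolding

/-!
# Sketch — crux-ideate round 1, ideator 2, crux `GpcZeta4Eq4zeta31` (stmt-KontsevichZagierPeriods-0275)

First-lemma signatures of the idea cards (statements only; `def … : Prop`, no proofs claimed).
All constants are existing declarations (`KZ.IntegralRep`, `KZ.of`, `KZ.relations`,
`KZ.openOrderedSimplex`).
-/

noncomputable section

namespace Summit.KontsevichZagierPeriods.KontsevichZagierPeriods.Cruxes.GpcZeta4Eq4zeta31.Ideator2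

open Set MeasureTheory
open Literature.NumberTheory.Transcendental
open Literature.NumberTheory.Transcendental.KZ

/-- The open unit cube `(0,1)^4`. -/
def openCube4 : Set (Fin 4 → ℝ) := {x | ∀ i, x i ∈ Ioo (0 : ℝ) 1}

/-! ## Card `positive-cubical-double-shuffle` — first lemma

The weight-4 STUFFLE inside the calculus, cube-internally: three integrand-additivity moves with
POSITIVE (hence absolutely integrable, dominated by the `ζ(2)²` kernel) pieces and one block-swap
change of variables. `c` = cubical `ζ(2)²` kernel, `c22` = cubical `ζ(2,2)` kernel, `c4` = cubical
`ζ(4)` kernel, all on `(0,1)^4`. -/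
def CubicalStuffleTwoTwo : Prop :=
  ∀ (c c22 c4 : IntegralRep 4),
    c.domain = openCube4 → c22.domain = openCube4 → c4.domain = openCube4 →
    EqOn c.integrand (fun x => 1 / ((1 - x 0 * x 1) * (1 - x 2 * x 3))) openCube4 →
    EqOn c22.integrand (fun x => x 0 * x 1 / ((1 - x 0 * x 1) * (1 - x 0 * x 1 * x 2 * x 3))) openCube4 →
    EqOn c4.integrand (fun x => 1 / (1 - x 0 * x 1 * x 2 * x 3)) openCube4 →
    of c - 2 • of c22 - of c4 ∈ relations

/-- Second lemma of the same card: the weight-4 cubical change of variables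
`Φ(x) = (x₀, x₀x₁, x₀x₁x₂, x₀x₁x₂x₃)` of the open cube onto the open ordered simplex is ONE move for
the `ζ(4)` kernel (template: `CubeCoV.cubeRep₂_equivalent` of the StuffleInKZ disprover, w = 2). -/
def CubicalCoVFour : Prop :=
  ∀ (c4 : IntegralRep 4) (m4 : IntegralRep 4),
    c4.domain = openCube4 → m4.domain = openOrderedSimplex 4 →
    EqOn c4.integrand (fun x => 1 / (1 - x 0 * x 1 * x 2 * x 3)) openCube4 →
    EqOn m4.integrand (fun t => 1 / (t 0 * t 1 * t 2 * (1 - t 3))) (openOrderedSimplex 4) →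
    of c4 - of m4 ∈ relations

/-- The cubical chart for the `ζ(3,1)` kernel `x₀x₁x₂/((1−x₀x₁x₂)(1−x₀x₁x₂x₃))`: ONE move. -/
def CubicalCoVThreeOne : Prop :=
  ∀ (c31 : IntegralRep 4) (m31 : IntegralRep 4),
    c31.domain = openCube4 → m31.domain = openOrderedSimplex 4 →
    EqOn c31.integrand
      (fun x => x 0 * x 1 * x 2 / ((1 - x 0 * x 1 * x 2) * (1 - x 0 * x 1 * x 2 * x 3))) openCube4 →
    EqOn m31.integrand (fun t => 1 / (t 0 * t 1 * (1 - t 2) * (1 - t 3))) (openOrderedSimplex 4) →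
    of c31 - of m31 ∈ relations

/-- Variant (α) of the shuffle half (the product-cell dissection): the SHUFFLE `Δ₂ × Δ₂ = ⊔ 6 cells`
read on the cube through the product cubical map `(x₀, x₀x₁, x₂, x₂x₃)`: the `ζ(2)²` cube kernel splits
as `2·[ζ(2,2)] + 4·[ζ(3,1)]` (simplex reps). Kept for comparison with `ToricShuffleTwoTwo`. -/
def CubicalShuffleTwoTwo : Prop :=
  ∀ (c : IntegralRep 4) (m22 m31 : IntegralRep 4),
    c.domain = openCube4 → m22.domain = openOrderedSimplex 4 → m31.domain = openOrderedSimplex 4 →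
    EqOn c.integrand (fun x => 1 / ((1 - x 0 * x 1) * (1 - x 2 * x 3))) openCube4 →
    EqOn m22.integrand (fun t => 1 / (t 0 * (1 - t 1) * t 2 * (1 - t 3))) (openOrderedSimplex 4) →
    EqOn m31.integrand (fun t => 1 / (t 0 * t 1 * (1 - t 2) * (1 - t 3))) (openOrderedSimplex 4) →
    of c - 2 • of m22 - 4 • of m31 ∈ relations

/-- TORNHEIM DESCENT, step one (card `tornheim-descent-double-shuffle`, D1): cut the cube along
`x₁ = x₃`, rescale both halves back onto the full cube (`x₁ = x₃ z`, resp. `x₃ = x₁ z`, Jacobians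
`x₃`, `x₁`), identify the two halves by the block swap: `[□, G] ≡ 2 • [□, H]` with
`G = 1/((1−x₀x₁)(1−x₂x₃))` (the `ζ(2)²` kernel, Tornheim type (2,2,0)) and
`H = x₃/((1−x₀x₁x₃)(1−x₂x₃))` (Tornheim type (2,1,1)). Six move instances. -/
def TornheimDescentStepOne : Prop :=
  ∀ (c h : IntegralRep 4),
    c.domain = openCube4 → h.domain = openCube4 →
    EqOn c.integrand (fun x => 1 / ((1 - x 0 * x 1) * (1 - x 2 * x 3))) openCube4 →
    EqOn h.integrand (fun x => x 3 / ((1 - x 0 * x 1 * x 3) * (1 - x 2 * x 3))) openCube4 →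
    of c - 2 • of h ∈ relations

/-- The SHUFFLE half, cube-internally (D1 + D2 + D3 of the card): three Tornheim descents give
`[□, G] ≡ 2 • [□, K₂₂] + 4 • [□, K₃₁]` with the cubical `ζ(2,2)` and `ζ(3,1)` kernels — no product
cell, no simplices. -/
def ToricShuffleTwoTwo : Prop :=
  ∀ (c c22 c31 : IntegralRep 4),
    c.domain = openCube4 → c22.domain = openCube4 → c31.domain = openCube4 →
    EqOn c.integrand (fun x => 1 / ((1 - x 0 * x 1) * (1 - x 2 * x 3))) openCube4 →
    EqOn c22.integrand (fun x => x 0 * x 1 / ((1 - x 0 * x 1) * (1 - x 0 * x 1 * x 2 * x 3))) openCube4 →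
    EqOn c31.integrand
      (fun x => x 0 * x 1 * x 2 / ((1 - x 0 * x 1 * x 2) * (1 - x 0 * x 1 * x 2 * x 3))) openCube4 →
    of c - 2 • of c22 - 4 • of c31 ∈ relations

/-- Existence of the four cube representations (semialgebraic + absolutely convergent): the only
analytic input, inherited from `ζ(2) ⊗ ζ(2)` (product of two `CubeCoV.cubeRep₂`) and by
domination / transport. -/
def CubeRepsExist : Prop :=
  ∃ (c c22 c31 c4 : IntegralRep 4),
    c.domain = openCube4 ∧ c22.domain = openCube4 ∧ c31.domain = openCube4 ∧ c4.domain = openCube4 ∧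
    EqOn c.integrand (fun x => 1 / ((1 - x 0 * x 1) * (1 - x 2 * x 3))) openCube4 ∧
    EqOn c22.integrand (fun x => x 0 * x 1 / ((1 - x 0 * x 1) * (1 - x 0 * x 1 * x 2 * x 3))) openCube4 ∧
    EqOn c31.integrand
      (fun x => x 0 * x 1 * x 2 / ((1 - x 0 * x 1 * x 2) * (1 - x 0 * x 1 * x 2 * x 3))) openCube4 ∧
    EqOn c4.integrand (fun x => 1 / (1 - x 0 * x 1 * x 2 * x 3)) openCube4

/-- Shape of the line (statement only; the crux-plan skeleton proves it from the four lemmas by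
`relations.sub_mem` bookkeeping and the `Glue4.zeta4Calibration_of` packaging). -/
def LineShape : Prop :=
  CubicalStuffleTwoTwo → ToricShuffleTwoTwo → CubicalCoVFour → CubicalCoVThreeOne → CubeRepsExist →
    Summit.KontsevichZagierPeriods.KontsevichZagierPeriods.Theses.Grothendieck.GpcZeta4Eq4zeta31

/-! ## Card `heptagon-rotation-coboundary` — first lemma

The order-7 rotation of the cell `(0, t₃, t₂, t₁, t₀, 1, ∞)` of `M_{0,7}(ℝ)`, i.e. the rational
bijection `ρ(t) = (1 − t₃, 1 − t₃/t₀, 1 − t₃/t₁, 1 − t₃/t₂)` of the open ordered 4-simplex onto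
itself, with Jacobian `t₃³/(t₀t₁t₂)²`, is ONE change-of-variables move. -/
def rho7 (t : Fin 4 → ℝ) : Fin 4 → ℝ :=
  ![1 - t 3, 1 - t 3 / t 0, 1 - t 3 / t 1, 1 - t 3 / t 2]

/-- `[Δ₄, (g ∘ ρ) · |Jac ρ|] − [Δ₄, g] ∈ relations` for every pair of representations on the open
ordered simplex whose integrands are so related. -/
def HeptagonRotationMove : Prop :=
  ∀ (r r' : IntegralRep 4),
    r.domain = openOrderedSimplex 4 → r'.domain = openOrderedSimplex 4 →
    (∀ t ∈ openOrderedSimplex 4,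
      r.integrand t = r'.integrand (rho7 t) * (t 3 ^ 3 / (t 0 * t 1 * t 2) ^ 2)) →
    of r - of r' ∈ relations

/-- The coboundary certificate shape (card `heptagon-rotation-coboundary`): IF the weight-4 defect
`ω_[4] − 4·ω_[3,1]` is, as a rational function on `Δ₄`, a `ℚ`-combination of dihedral coboundaries
`σ^*g − g` of absolutely integrable semialgebraic `g`, THEN the crux follows from
`HeptagonRotationMove` (+ the reflection `t ↦ (1 − t₃, …, 1 − t₀)`) and integrand additivity alone.
Stated here for ONE coboundary of ONE function `g` under `ρ` (the general case is a finite sum). -/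
def OneCoboundarySuffices : Prop :=
  ∀ (g : (Fin 4 → ℝ) → ℝ) (q : ℚ),
    IntegrableOn g (openOrderedSimplex 4) volume →
    IsSemialgebraicFunOn ℚ (openOrderedSimplex 4) g →
    (∀ t ∈ openOrderedSimplex 4,
      1 / (t 0 * t 1 * t 2 * (1 - t 3)) - 4 / (t 0 * t 1 * (1 - t 2) * (1 - t 3)) =
        (q : ℝ) * (g (rho7 t) * (t 3 ^ 3 / (t 0 * t 1 * t 2) ^ 2) - g t)) →
    Summit.KontsevichZagierPeriods.KontsevichZagierPeriods.Theses.Grothendieck.GpcZeta4Eq4zeta31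

end Summit.KontsevichZagierPeriods.KontsevichZagierPeriods.Cruxes.GpcZeta4Eq4zeta31.Ideator2
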